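import Literature.MathematicalPhysics.QuantumFieldTheory.Balaban1983to89.B9Thm311InverseL2BoundsZd
import Literature.MathematicalPhysics.QuantumFieldTheory.Balaban1983to89.B9Eq386GreenContinuityZd

/-!
# `Balaban1983to89.B9Eq324GreenPrimeContinuityZd` — [Balaban1985BackgroundPropagators] (3.24) p. 394 ∕ Thm 3.1 p. 397 ∕ (3.84)–(3.86) p. 407: THE SECOND RESOLVENT IDENTITY
# AND `L²_τ`-OPERATOR-NORM CONTINUITY IN THE BACKGROUND FOR `G′(U₀) = (Ω₀Δ′_a(U₀)Ω₀)⁻¹` AT THE `ℤᵈ × 𝔸` CARRIER — `G′(U) − G′(V) = G′(U)(Δ′_a(V) − Δ′_a(U))G′(V)`,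
# `‖G′(U)f − G′(V)f‖_τ ≤ c′⁻¹‖(Δ′_a(V) − Δ′_a(U))G′(V)f‖_τ`, and `∀ ε > 0`, for all `U` of the closed class (1.7) near `V`: `‖G′(U)f − G′(V)f‖²_τ ≤ ε‖f‖²_τ` —
# the `G′` twin of this seat's `B9Eq386ResolventBoundZd` ∕ `B9Eq386GreenContinuityZd` (there: the genuine `G_𝔤`)

statement-level skeleton of published theorems with citation tags; proofs where landed; nothing here is a claim about the
Yang–Mills mass gap

`[Balaban1985BackgroundPropagators]` ("B9", CMP **99** (1985) 389–434) p. 394 (3.24) («Its inverse is denoted by G′, or G′(U)»), p. 397 Thm 3.1, p. 407 (3.84)–(3.86) (the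
perturbation structure `G(U′U) = G(U)(I − V(A)G(U))⁻¹`, here for `G′` to first order and qualitatively).  dag-n06-w4 g3's `B9Eq325ProjContinuityZd.continuousAt_GpZd` is the
POINTWISE continuity (fixed `f`); this file gives the OPERATOR-NORM form with ONE coercivity constant.  PDF held: `paper:balaban1985-cmp99-background-propagators` pp. 394–397, 407.

CITATION HEADER (lean-in-tree rule).  Cell `pub-ymgap` (YM Track A, D-0062 ∕ D-0149), node N06 = [B9], width seat `pub-ymgap-dag-n06-w4` (g4), CLAIM-10 ∕ INTENT-10.  Inputs BY NAME:
this seat's g2 `B9Eq324DeltaPrimeAZd` (`GpZd`, `GpZd_deltaPrimeADom`, `deltaPrimeADom_GpZd`, `finiteDimensional_suppSub'`), g0 `B9Eq321LandauProjectionZd` (`formE`, `formE_isSymm`,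
`formE_apply_self_eq_zero`), g4 `B9Thm311InverseL2BoundsZd` (`formE_GpZd_self_le_of_coercive`, `formE_self_nonneg'`), g4 `B9Eq386GreenContinuityZd.eventually_abs_le_of_entries_tendsto_zero`,
g4 `B9Thm31CoercivePrimeCompactZd` (`continuousAt_formE_deltaPrimeADom_of_reg17UnivP`, `exists_coercive_formE_deltaPrimeADom_plaqClosed`, `plaqClosed_subset_reg17UnivP`).

WHAT IS PROVED (kernel, 0 sorry; theorems only — no `def`, `instance`, `notation`; generic `Ω₀ = s`, `m`, `a ≥ 0`, `Λ`; `0 < d`, `η ≠ 0`; Hermitian faithful tracial `τ` a PARAMETER).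
* §1 ★ `GpZd_sub_eq` — `G′(U)f − G′(V)f = G′(U)[Δ′_a(V)(G′(V)f) − Δ′_a(U)(G′(V)f)]` (every pair of unitary backgrounds).
* §2 ★★ `formE_GpZd_sub_self_le` — `c`-coercivity of `Ω₀Δ′_a(U)Ω₀` ⟹ `⟨G′(U)f − G′(V)f, ·⟩_τ ≤ c⁻²·⟨W, W⟩_τ`, `W = (Δ′_a(V) − Δ′_a(U))(G′(V)f)`.
* §3 ★★★ `eventually_formE_GpZd_sub_le` — on `S ⊆ 𝒰′` with ONE coercivity constant: `∀ V ∈ S, ∀ ε > 0, ∀ᶠ U in 𝓝[S] V, ‖G′(U)f − G′(V)f‖²_τ ≤ ε‖f‖²_τ` for all `f`.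
* §4 ★★★★ `eventually_formE_GpZd_sub_le_plaqClosed` — on the closed class «unitary ∧ all plaquettes ≤ β», `β < (α_Q∕L²)L^{−2m}`, the constant supplied by
  `B9Thm31CoercivePrimeCompactZd`: `G′` IS CONTINUOUS IN THE BACKGROUND IN `L²_τ`-OPERATOR NORM along the class, at every point of it.

HONEST SCOPE.  QUALITATIVE (no rate); `L²_τ` currency; constants NON-QUANTITATIVE; `τ` a PARAMETER; count-neutral helper (`--supports` the K1 item of record); N05 ∕ N06 NOT
discharged; K1 NOT closed; one finite `𝕋⁴` programme at fixed `ε`, Bałaban as printed; R4 closes only the conditional finite-`𝕋⁴` rung `BalabanLadder.UV` — nothing continuum ∕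
ℝ⁴ ∕ OS ∕ mass gap ∕ Clay.  Unit `pub-ymgap-dag-n06-w4` (g4), 2026-08-28.
-/

noncomputable section

namespace Literature.MathematicalPhysics.QuantumFieldTheory.Balaban1983to89.B9Eq324GreenPrimeContinuityZd

open Filter Topology
open B7Prop1Explicit
open B7Prop2Explicit (unitaryUnits)
open B8Ineq132 (plaqF)
open B9Eq316AveragingTransposeZd (Reg17 alphaQ)
open B9Eq321LandauProjectionZd (suppSub formE formE_isSymm formE_apply_self_eq_zero)
open B9Eq324DeltaPrimeAZd (deltaPrimeADom GpZd GpZd_deltaPrimeADom deltaPrimeADom_GpZd finiteDimensional_suppSub')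
open B9Thm31CoercivePrimeCompactZd (continuousAt_formE_deltaPrimeADom_of_reg17UnivP exists_coercive_formE_deltaPrimeADom_plaqClosed plaqClosed_subset_reg17UnivP)
open B9Thm311InverseL2BoundsZd (formE_GpZd_self_le_of_coercive formE_self_nonneg')
open B9Eq386GreenContinuityZd (eventually_abs_le_of_entries_tendsto_zero)

export B7Prop1Explicit (Site)

variable {d : ℕ} {𝔸 : Type*} [CStarAlgebra 𝔸] [FiniteDimensional ℝ 𝔸] [Nontrivial 𝔸]
variable (τ : 𝔸 →ₗ[ℂ] ℂ) (hτp : ∀ a : 𝔸, a ≠ 0 → 0 < (τ (star a * a)).re) {L : ℕ} {η : ℝ}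
  (hτt : ∀ a b : 𝔸, τ (a * b) = τ (b * a)) (hτs : ∀ a : 𝔸, τ (star a) = starRingEnd ℂ (τ a))

/-! ## §1  The second resolvent identity for `G′` -/

omit [Nontrivial 𝔸] in
/-- ★ **`G′(U)f − G′(V)f = G′(U)[Δ′_a(V)(G′(V)f) − Δ′_a(U)(G′(V)f)]`** for every pair of unitary backgrounds (`G′(U)Ω₀Δ′_a(U)Ω₀ = 1`, `Ω₀Δ′_a(V)Ω₀G′(V) = 1`).
[cite: Balaban1985BackgroundPropagators, (3.84)–(3.86) p.407, (3.24) p.394] -/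
theorem GpZd_sub_eq (hd : 0 < d) (hη : η ≠ 0) (m : ℕ) {a : ℕ → ℝ} (ha : ∀ j, 0 ≤ a j) (Λ : ℕ → Finset (Site d)) (s : Finset (Site d))
    {U V : Site d → Fin d → 𝔸ˣ} (hU : ∀ (x : Site d) (κ : Fin d), U x κ ∈ unitaryUnits 𝔸) (hV : ∀ (x : Site d) (κ : Fin d), V x κ ∈ unitaryUnits 𝔸)
    (f : suppSub (𝔸 := 𝔸) s) :
    GpZd L U η τ hτp m a Λ s hd hη hτt hτs hU ha f - GpZd L V η τ hτp m a Λ s hd hη hτt hτs hV ha f =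
      GpZd L U η τ hτp m a Λ s hd hη hτt hτs hU ha
        (deltaPrimeADom L V η τ hτp m a Λ s (GpZd L V η τ hτp m a Λ s hd hη hτt hτs hV ha f) -
          deltaPrimeADom L U η τ hτp m a Λ s (GpZd L V η τ hτp m a Λ s hd hη hτt hτs hV ha f)) := by
  rw [map_sub, deltaPrimeADom_GpZd hd hη hτt hτs hV ha f, GpZd_deltaPrimeADom hd hη hτt hτs hU ha]

/-! ## §2  The comparison bound from a coercivity constant -/

omit [Nontrivial 𝔸] in
include hτs in
/-- ★★ **`⟨G′(U)f − G′(V)f, ·⟩_τ ≤ c⁻²·⟨W, W⟩_τ`, `W = Δ′_a(V)(G′(V)f) − Δ′_a(U)(G′(V)f)`**, when `Ω₀Δ′_a(U)Ω₀` is `c`-coercive on `L²(Ω₀, ·)` (`c > 0`).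
[cite: Balaban1985BackgroundPropagators, (3.86) p.407, Thm 3.1 p.397; Balaban1984PropagatorsII, (2.22) p.226] -/
theorem formE_GpZd_sub_self_le (hd : 0 < d) (hη : η ≠ 0) (m : ℕ) {a : ℕ → ℝ} (ha : ∀ j, 0 ≤ a j) (Λ : ℕ → Finset (Site d)) (s : Finset (Site d))
    {U V : Site d → Fin d → 𝔸ˣ} (hU : ∀ (x : Site d) (κ : Fin d), U x κ ∈ unitaryUnits 𝔸) (hV : ∀ (x : Site d) (κ : Fin d), V x κ ∈ unitaryUnits 𝔸)
    {c : ℝ} (hc : 0 < c) (hco : ∀ g : suppSub (𝔸 := 𝔸) s, c * formE τ s g g ≤ formE τ s g (deltaPrimeADom L U η τ hτp m a Λ s g))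
    (f : suppSub (𝔸 := 𝔸) s) :
    formE τ s (GpZd L U η τ hτp m a Λ s hd hη hτt hτs hU ha f - GpZd L V η τ hτp m a Λ s hd hη hτt hτs hV ha f)
        (GpZd L U η τ hτp m a Λ s hd hη hτt hτs hU ha f - GpZd L V η τ hτp m a Λ s hd hη hτt hτs hV ha f) ≤
      c⁻¹ ^ 2 * formE τ s
        (deltaPrimeADom L V η τ hτp m a Λ s (GpZd L V η τ hτp m a Λ s hd hη hτt hτs hV ha f) -
          deltaPrimeADom L U η τ hτp m a Λ s (GpZd L V η τ hτp m a Λ s hd hη hτt hτs hV ha f))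
        (deltaPrimeADom L V η τ hτp m a Λ s (GpZd L V η τ hτp m a Λ s hd hη hτt hτs hV ha f) -
          deltaPrimeADom L U η τ hτp m a Λ s (GpZd L V η τ hτp m a Λ s hd hη hτt hτs hV ha f)) := by
  rw [GpZd_sub_eq τ hτp hτt hτs hd hη m ha Λ s hU hV f]
  exact formE_GpZd_self_le_of_coercive τ hτp hτt hτs hd hη m ha Λ s hU hc hco _

/-! ## §3  `G′` is continuous in the background in `L²_τ`-operator norm along a uniformly coercive family in the regime -/

include hτp hτs in
/-- ★★★ **`G′(U) → G′(V)` IN `L²_τ`-OPERATOR NORM AS `U → V` WITHIN A UNIFORMLY COERCIVE FAMILY OF REGIME BACKGROUNDS**: `S ⊆ 𝒰′` with ONE `c > 0` such that `Ω₀Δ′_a(U)Ω₀` is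
`c`-coercive for every `U ∈ S`, `V ∈ S` (`0 < d`, `2 ≤ L`, `η ≠ 0`, `a ≥ 0`): for every `ε > 0`, for all `U ∈ S` near `V` (product topology) and every `f ∈ L²(Ω₀, ·)`,
`⟨G′(U)f − G′(V)f, G′(U)f − G′(V)f⟩_τ ≤ ε·⟨f, f⟩_τ` — resolvent identity + `‖G′(U)‖ ≤ c⁻¹` + the entries of `Δ′_a(U) − Δ′_a(V)` tending to `0` (this seat's engine).
[cite: Balaban1985BackgroundPropagators, (3.86) p.407 («convergence is in the operator norm»), Thm 3.1 p.397, (3.24) p.394; Balaban1985RegularSpaces, (1.7) p.77] -/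
theorem eventually_formE_GpZd_sub_le (hd : 0 < d) (hL : 2 ≤ L) (hη : η ≠ 0) (m : ℕ) {a : ℕ → ℝ} (ha : ∀ j, 0 ≤ a j) (Λ : ℕ → Finset (Site d))
    (s : Finset (Site d)) {S : Set (Site d → Fin d → 𝔸ˣ)}
    (hS : S ⊆ {U₀ : Site d → Fin d → 𝔸ˣ | (∀ x κ, U₀ x κ ∈ unitaryUnits 𝔸) ∧
        Reg17 L m (fun _ => (Set.univ : Set (Site d))) (alphaQ d L / (L : ℝ) ^ 2) U₀})
    {c : ℝ} (hc : 0 < c) (hco : ∀ U ∈ S, ∀ g : suppSub (𝔸 := 𝔸) s, c * formE τ s g g ≤ formE τ s g (deltaPrimeADom L U η τ hτp m a Λ s g))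
    {V : Site d → Fin d → 𝔸ˣ} (hV : V ∈ S) {ε : ℝ} (hε : 0 < ε) :
    ∀ᶠ U in 𝓝[S] V, ∀ (hU : ∀ (x : Site d) (κ : Fin d), U x κ ∈ unitaryUnits 𝔸) (f : suppSub (𝔸 := 𝔸) s),
      formE τ s (GpZd L U η τ hτp m a Λ s hd hη hτt hτs hU ha f - GpZd L V η τ hτp m a Λ s hd hη hτt hτs (hS hV).1 ha f)
          (GpZd L U η τ hτp m a Λ s hd hη hτt hτs hU ha f - GpZd L V η τ hτp m a Λ s hd hη hτt hτs (hS hV).1 ha f) ≤ ε * formE τ s f f := by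
  haveI := finiteDimensional_suppSub' (𝔸 := 𝔸) s
  -- the entries `r U (h, g) = ⟨h, (Δ′_a(U) − Δ′_a(V)) g⟩_τ` tend to `0` within `S` at `V`
  let r : (Site d → Fin d → 𝔸ˣ) → suppSub (𝔸 := 𝔸) s →ₗ[ℝ] suppSub (𝔸 := 𝔸) s →ₗ[ℝ] ℝ :=
    fun U => (formE τ s).compl₂ (deltaPrimeADom L U η τ hτp m a Λ s - deltaPrimeADom L V η τ hτp m a Λ s)
  have hr_apply : ∀ U (h g : suppSub (𝔸 := 𝔸) s),
      r U h g = formE τ s h (deltaPrimeADom L U η τ hτp m a Λ s g) - formE τ s h (deltaPrimeADom L V η τ hτp m a Λ s g) := by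
    intro U h g
    simp only [r, LinearMap.compl₂_apply, LinearMap.sub_apply, map_sub]
  have hr : ∀ h g : suppSub (𝔸 := 𝔸) s, Tendsto (fun U => r U h g) (𝓝[S] V) (𝓝 0) := by
    intro h g
    have hcont := (continuousAt_formE_deltaPrimeADom_of_reg17UnivP τ hτp hd hL η m a Λ s (hS hV).1 (hS hV).2 h g).continuousWithinAt (s := S)
    have h1 := hcont.tendsto.sub_const (formE τ s h (deltaPrimeADom L V η τ hτp m a Λ s g))
    rw [sub_self] at h1
    exact h1.congr fun U => (hr_apply U h g).symm
  have hNpos : ∀ g : suppSub (𝔸 := 𝔸) s, g ≠ 0 → 0 < formE τ s g g :=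
    fun g hg => lt_of_le_of_ne (formE_self_nonneg' τ hτp s g) fun h0 => hg (formE_apply_self_eq_zero τ s hτp h0.symm)
  set ε₁ : ℝ := min (1 / 2) (ε * c ^ 4 / 2) with hε₁
  have hε₁pos : 0 < ε₁ := lt_min (by norm_num) (by positivity)
  have hε₁half : ε₁ ≤ 1 / 2 := min_le_left _ _
  have hε₁le : ε₁ ≤ ε * c ^ 4 / 2 := min_le_right _ _
  have hev := eventually_abs_le_of_entries_tendsto_zero r (formE τ s) hr hNpos hε₁pos
  filter_upwards [hev, eventually_mem_nhdsWithin] with U hUr hUS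
  intro hU f
  set g := GpZd L V η τ hτp m a Λ s hd hη hτt hτs (hS hV).1 ha f with hgdef
  set D := GpZd L U η τ hτp m a Λ s hd hη hτt hτs hU ha f - g with hDdef
  obtain ⟨W, hWdef⟩ : ∃ W : suppSub (𝔸 := 𝔸) s, W = deltaPrimeADom L V η τ hτp m a Λ s g - deltaPrimeADom L U η τ hτp m a Λ s g := ⟨_, rfl⟩
  -- step 1: `⟨D, D⟩ ≤ c⁻² ⟨W, W⟩`
  have h1 : formE τ s D D ≤ c⁻¹ ^ 2 * formE τ s W W := by
    have h := formE_GpZd_sub_self_le τ hτp hτt hτs hd hη m ha Λ s hU (hS hV).1 hc (hco U hUS) f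
    rw [← hWdef] at h
    exact h
  -- step 2: `⟨W, W⟩ = −r U W g ≤ ε₁ (⟨W,W⟩ + ⟨g,g⟩)`, hence `⟨W,W⟩ ≤ 2ε₁⟨g,g⟩`
  have hkey : ∀ X : suppSub (𝔸 := 𝔸) s, formE τ s X W =
      formE τ s X (deltaPrimeADom L V η τ hτp m a Λ s g) - formE τ s X (deltaPrimeADom L U η τ hτp m a Λ s g) := fun X => by
    rw [hWdef, map_sub]
  have hWW : formE τ s W W = -(r U W g) := by
    rw [hr_apply, hkey W]
    ring
  have hWnn : 0 ≤ formE τ s W W := formE_self_nonneg' τ hτp s W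
  have hgnn : 0 ≤ formE τ s g g := formE_self_nonneg' τ hτp s g
  have hfnn : 0 ≤ formE τ s f f := formE_self_nonneg' τ hτp s f
  have hWle : formE τ s W W ≤ ε₁ * (formE τ s W W + formE τ s g g) := by
    have h := hUr W g
    have h' : -(r U W g) ≤ |r U W g| := neg_le_abs _
    linarith [hWW]
  have hW2 : formE τ s W W ≤ 2 * ε₁ * formE τ s g g := by nlinarith [hWle, hε₁half, hWnn]
  -- step 3: `⟨g, g⟩ ≤ c⁻² ⟨f, f⟩`
  have hgg : formE τ s g g ≤ c⁻¹ ^ 2 * formE τ s f f :=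
    formE_GpZd_self_le_of_coercive τ hτp hτt hτs hd hη m ha Λ s (hS hV).1 hc (hco V hV) f
  have hc2 : 0 < c⁻¹ ^ 2 := by positivity
  have hchain : formE τ s D D ≤ c⁻¹ ^ 2 * (2 * ε₁ * (c⁻¹ ^ 2 * formE τ s f f)) := by
    calc formE τ s D D ≤ c⁻¹ ^ 2 * formE τ s W W := h1
      _ ≤ c⁻¹ ^ 2 * (2 * ε₁ * formE τ s g g) := mul_le_mul_of_nonneg_left hW2 hc2.le
      _ ≤ c⁻¹ ^ 2 * (2 * ε₁ * (c⁻¹ ^ 2 * formE τ s f f)) :=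
          mul_le_mul_of_nonneg_left (mul_le_mul_of_nonneg_left hgg (by positivity)) hc2.le
  have hconst : c⁻¹ ^ 2 * (2 * ε₁ * (c⁻¹ ^ 2 * formE τ s f f)) ≤ ε * formE τ s f f := by
    have hcc : c⁻¹ ^ 2 * (2 * ε₁ * (c⁻¹ ^ 2 * formE τ s f f)) = (2 * ε₁ * (c ^ 4)⁻¹) * formE τ s f f := by
      field_simp
    rw [hcc]
    refine mul_le_mul_of_nonneg_right ?_ hfnn
    have hc4 : 0 < c ^ 4 := by positivity
    rw [mul_inv_le_iff₀ hc4]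
    linarith
  exact hchain.trans hconst

/-! ## §4  On the closed class (1.7) on `ℤᵈ`, with the constant of `B9Thm31CoercivePrimeCompactZd` -/

include hτp hτt hτs in
/-- ★★★★ **`G′(U₀)` IS CONTINUOUS IN THE BACKGROUND IN `L²_τ`-OPERATOR NORM ALONG THE CLOSED CLASS (1.7) ON `ℤᵈ`**: for every `β < (α_Q∕L²)·L^{−2m}`, on
`K_β = {unitary ∧ every plaquette within β of 1}`, at EVERY `V ∈ K_β`: `∀ ε > 0`, for all `U ∈ K_β` near `V` and every `f ∈ L²(Ω₀, ·)`, `‖G′(U)f − G′(V)f‖²_τ ≤ ε·‖f‖²_τ`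
(generic `Ω₀ = s`, `m`, `a ≥ 0`, `Λ`; `0 < d`, `2 ≤ L`, `η ≠ 0`).
[cite: Balaban1985BackgroundPropagators, (3.86) p.407, Thm 3.1 p.397; Balaban1985RegularSpaces, (1.7) p.77] -/
theorem eventually_formE_GpZd_sub_le_plaqClosed (hd : 0 < d) (hL : 2 ≤ L) (hη : η ≠ 0) (m : ℕ) {a : ℕ → ℝ} (ha : ∀ j, 0 ≤ a j)
    (Λ : ℕ → Finset (Site d)) (s : Finset (Site d)) {β : ℝ} (hβ : β < alphaQ d L / (L : ℝ) ^ 2 * (((L : ℝ) ^ m)⁻¹) ^ 2)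
    {V : Site d → Fin d → 𝔸ˣ} (hVu : ∀ (x : Site d) (κ : Fin d), V x κ ∈ unitaryUnits 𝔸) (hVβ : ∀ (x : Site d) (μ ν : Fin d), ‖plaqF V μ ν x - 1‖ ≤ β)
    {ε : ℝ} (hε : 0 < ε) :
    ∀ᶠ U in 𝓝[{U₀ : Site d → Fin d → 𝔸ˣ | (∀ x κ, U₀ x κ ∈ unitaryUnits 𝔸) ∧ ∀ (x : Site d) (μ ν : Fin d), ‖plaqF U₀ μ ν x - 1‖ ≤ β}] V,
      ∀ (hU : ∀ (x : Site d) (κ : Fin d), U x κ ∈ unitaryUnits 𝔸) (f : suppSub (𝔸 := 𝔸) s),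
        formE τ s (GpZd L U η τ hτp m a Λ s hd hη hτt hτs hU ha f - GpZd L V η τ hτp m a Λ s hd hη hτt hτs hVu ha f)
            (GpZd L U η τ hτp m a Λ s hd hη hτt hτs hU ha f - GpZd L V η τ hτp m a Λ s hd hη hτt hτs hVu ha f) ≤ ε * formE τ s f f := by
  have hL1 : 1 ≤ L := le_trans one_le_two hL
  obtain ⟨c, hc, hco⟩ := exists_coercive_formE_deltaPrimeADom_plaqClosed τ hτp hτt hτs hd hL hη m ha Λ s hβ
  have hS := plaqClosed_subset_reg17UnivP (d := d) (𝔸 := 𝔸) hL1 m hβ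
  exact eventually_formE_GpZd_sub_le τ hτp hτt hτs hd hL hη m ha Λ s hS hc (fun U hU g => hco U hU.1 hU.2 g) ⟨hVu, hVβ⟩ hε

end Literature.MathematicalPhysics.QuantumFieldTheory.Balaban1983to89.B9Eq324GreenPrimeContinuityZd

end
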